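import Mathlib
import HarnessLib

/-!
# Forster's Theorem 4.1, part I: the first-order condition of the log-volume functional

Route `route-QuantumAdvantage-HankelLift`; infrastructure toward DISCHARGING the named fact
`Literature.Computability.Complexity.ForsterIsotropicPosition` (Forster 2002, Thm 4.1: radial
isotropic position), on which the sign-rank rung of `HankelLift.BeyondRectangles`
(stmt-QuantumAdvantage-18440) now rests.

We use the variational route (not Forster's iteration): for a family `u : X → ℝ^k` and an
invertible `A`, let `Φ(A) = ∑_x log ‖A u_x‖² − (|X|/k)·log (det A)²` (scale invariant).  This file
proves the FIRST-ORDER CONDITION: if `A₀` minimizes `Φ` among invertible matrices then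
`∑_x (A₀u_x)(A₀u_x)ᵀ/‖A₀u_x‖² = (|X|/k)·I`, i.e. `A₀` puts `u` in radial isotropic position
(`isotropic_of_isMinOn`).  Proof: perturb `A₀ ↦ (1 + t·E_{ij})A₀`; then
`‖(1+tE_{ij})w‖² = ‖w‖² + 2t wᵢwⱼ + t²wⱼ²` and `det(1 + tE_{ij}) = 1 + δ_{ij}t + O(t²)`
(`Matrix.det_one_add_smul`), so `t ↦ Φ((1+tE_{ij})A₀)` is an explicit differentiable function
with a local minimum at `0`; its derivative `∑_x 2wᵢwⱼ/‖w‖² − (|X|/k)·2δ_{ij}` vanishes.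
Also: the trivial case `|X| = k` of Theorem 4.1 (`exists_isotropic_of_basis`).
The existence of a minimizer (coercivity from general position) is part II.
[cite: Forster2002, Theorem 4.1]
-/

set_option linter.dupNamespace false -- D-0017: single-problem summit ⇒ `QuantumAdvantage.QuantumAdvantage` by design

noncomputable section

namespace Summit.QuantumAdvantage.QuantumAdvantage.Theorems.HankelLift.Forster

open Finset Real Matrix

/-! ## From the matrix identity to the quadratic form -/

/-- If `∑_x w_{x,i} w_{x,j}/‖w_x‖² = c·δ_{ij}` for all `i, j`, then `∑_x ⟨w_x, v⟩²/‖w_x‖² = c‖v‖²`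
for all `v`. [folklore] -/
theorem quadForm_of_entries {X : Type*} [Fintype X] {k : ℕ} (w : X → Fin k → ℝ) (c : ℝ)
    (h : ∀ i j : Fin k, ∑ x, w x i * w x j / (w x ⬝ᵥ w x) = c * (if i = j then 1 else 0))
    (v : Fin k → ℝ) : ∑ x, (w x ⬝ᵥ v) ^ 2 / (w x ⬝ᵥ w x) = c * (v ⬝ᵥ v) := by
  have hexp : ∀ x, (w x ⬝ᵥ v) ^ 2 / (w x ⬝ᵥ w x) =
      ∑ i, ∑ j, v i * v j * (w x i * w x j / (w x ⬝ᵥ w x)) := by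
    intro x
    rw [sq, dotProduct, Finset.sum_mul_sum, Finset.sum_div]
    refine Finset.sum_congr rfl fun i _ => ?_
    rw [Finset.sum_div]
    refine Finset.sum_congr rfl fun j _ => ?_
    ring
  rw [Finset.sum_congr rfl fun x _ => hexp x, Finset.sum_comm]
  rw [Finset.sum_congr rfl fun i _ => Finset.sum_comm]
  simp_rw [← Finset.mul_sum, h]
  rw [dotProduct, Finset.mul_sum]
  refine Finset.sum_congr rfl fun i _ => ?_
  rw [Finset.sum_eq_single i]
  · simp; ring
  · intro j _ hji; simp [Ne.symm hji]
  · intro hi; exact absurd (Finset.mem_univ i) hi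

/-! ## The trivial case `|X| = k` -/

/-- **Theorem 4.1 for `|X| = k`**: a linearly independent family of `k` vectors in `ℝ^k` is mapped by
a nonsingular matrix onto the standard basis, which is in radial isotropic position with constant
`1 = |X|/k`. [cite: Forster2002, Theorem 4.1 (case |X| = k)] -/
theorem exists_isotropic_of_basis {X : Type} [Fintype X] [DecidableEq X] {k : ℕ}
    (u : X → Fin k → ℝ) (hk : k = Fintype.card X)
    (hli : LinearIndependent ℝ u) :
    ∃ A : Matrix (Fin k) (Fin k) ℝ, IsUnit A.det ∧ ∀ w : Fin k → ℝ,
      ∑ x, (A *ᵥ u x ⬝ᵥ w) ^ 2 / (A *ᵥ u x ⬝ᵥ A *ᵥ u x) =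
        (Fintype.card X : ℝ) / k * (w ⬝ᵥ w) := by
  classical
  -- index `X` by `Fin k`
  let e : X ≃ Fin k := (Fintype.equivFinOfCardEq hk.symm)
  -- the matrix `U` with columns `u (e.symm j)`
  let U : Matrix (Fin k) (Fin k) ℝ := Matrix.of fun i j => u (e.symm j) i
  have hUcol : ∀ j, U *ᵥ Pi.single j 1 = u (e.symm j) := by
    intro j; ext i; rw [Matrix.mulVec_single_one]; rfl
  -- `U` is invertible: its columns are linearly independent
  have hUdet : IsUnit U.det := by
    rw [← Matrix.isUnit_iff_isUnit_det]
    rw [← Matrix.mulVec_injective_iff_isUnit]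
    -- injectivity of `U *ᵥ ·` from linear independence of the columns
    intro a b hab
    have hlin : ∀ c : Fin k → ℝ, U *ᵥ c = ∑ j, c j • u (e.symm j) := by
      intro c
      have : c = ∑ j, c j • (Pi.single j (1 : ℝ) : Fin k → ℝ) := by
        ext i; simp [Finset.sum_apply, Pi.single_apply]
      conv_lhs => rw [this]
      rw [Matrix.mulVec_sum]
      refine Finset.sum_congr rfl fun j _ => ?_
      rw [Matrix.mulVec_smul, hUcol]
    have hli' : LinearIndependent ℝ (fun j : Fin k => u (e.symm j)) :=
      (linearIndependent_equiv e.symm).mpr hli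
    have h0 : ∑ j, (a j - b j) • u (e.symm j) = 0 := by
      simp only [sub_smul, Finset.sum_sub_distrib, ← hlin, hab, sub_self]
    have := Fintype.linearIndependent_iff.mp hli' (fun j => a j - b j) h0
    ext j; exact sub_eq_zero.mp (this j)
  refine ⟨U⁻¹, ?_, fun w => ?_⟩
  · rw [Matrix.det_nonsing_inv]; exact hUdet.ringInverse
  -- `U⁻¹ u_x = e_{e x}`
  have hAu : ∀ x, U⁻¹ *ᵥ u x = Pi.single (e x) 1 := by
    intro x
    have h := hUcol (e x)
    rw [Equiv.symm_apply_apply] at h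
    rw [← h, Matrix.mulVec_mulVec, Matrix.nonsing_inv_mul U hUdet, Matrix.one_mulVec]
  simp_rw [hAu]
  have hss : ∀ x, (Pi.single (e x) (1 : ℝ) : Fin k → ℝ) ⬝ᵥ Pi.single (e x) 1 = 1 := by
    intro x; simp
  have hsw : ∀ x, (Pi.single (e x) (1 : ℝ) : Fin k → ℝ) ⬝ᵥ w = w (e x) := by
    intro x; simp
  simp_rw [hss, hsw, div_one]
  rcases Nat.eq_zero_or_pos (Fintype.card X) with h0 | hpos
  · haveI : IsEmpty X := Fintype.card_eq_zero_iff.mp h0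
    simp
  · rw [← hk, div_self (by rw [hk]; exact_mod_cast hpos.ne'), one_mul, dotProduct,
      ← Equiv.sum_comp e (fun i => w i * w i)]
    exact Finset.sum_congr rfl fun x _ => by ring

/-! ## The first-order condition -/

/-- Coordinates of `(1 + t·E_{ij}) w`: `w + t·w_j·e_i`. [folklore] -/
theorem one_add_smul_single_mulVec {k : ℕ} (i j : Fin k) (t : ℝ) (w : Fin k → ℝ) :
    (1 + t • Matrix.single i j (1 : ℝ)) *ᵥ w = w + t • Pi.single i (w j) := by
  rw [Matrix.add_mulVec, Matrix.one_mulVec, Matrix.smul_mulVec, Matrix.single_mulVec, one_mul]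
  rfl

/-- `‖w + t·w_j·e_i‖² = ‖w‖² + 2t·w_i w_j + t²·w_j²`. [folklore] -/
theorem dotProduct_self_perturb {k : ℕ} (i j : Fin k) (t : ℝ) (w : Fin k → ℝ) :
    (w + t • Pi.single i (w j)) ⬝ᵥ (w + t • Pi.single i (w j)) =
      w ⬝ᵥ w + 2 * t * (w i * w j) + t ^ 2 * w j ^ 2 := by
  rw [add_dotProduct, dotProduct_add, dotProduct_add, dotProduct_smul, smul_dotProduct,
    smul_dotProduct, dotProduct_smul, dotProduct_single, single_dotProduct, single_dotProduct]
  simp only [smul_eq_mul, Pi.single_eq_same]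
  ring

/-- The determinant of `1 + t·E_{ij}` is `1 + δ_{ij} t + c(t)·t²` for a fixed real polynomial `c`
(`Matrix.det_one_add_smul`). [folklore] -/
theorem det_one_add_smul_single {k : ℕ} (i j : Fin k) :
    ∃ c : Polynomial ℝ, ∀ t : ℝ, (1 + t • Matrix.single i j (1 : ℝ)).det =
      1 + (if i = j then 1 else 0) * t + c.eval t * t ^ 2 := by
  refine ⟨(Matrix.det (1 + (Polynomial.X : Polynomial ℝ) •
    (Matrix.single i j (1 : ℝ)).map Polynomial.C)).divX.divX, fun t => ?_⟩
  rw [Matrix.det_one_add_smul]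
  congr 2
  by_cases h : i = j
  · subst h; rw [Matrix.trace_single_eq_same, if_pos rfl]
  · rw [Matrix.trace_single_eq_of_ne i j (1 : ℝ) h, if_neg h]

/-- **First-order condition (Forster's Theorem 4.1 at a minimizer).**  Let `u : X → ℝ^k`, and let
the invertible `A₀` minimize `Φ(A) = ∑_x log ‖A u_x‖² − (|X|/k) log (det A)²` over all invertible
`A`, with all `A₀ u_x ≠ 0`.  Then `∑_x ⟨A₀u_x, w⟩²/‖A₀u_x‖² = (|X|/k)‖w‖²` for every `w`.
[cite: Forster2002, Theorem 4.1] -/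
theorem isotropic_of_isMinOn {X : Type*} [Fintype X] {k : ℕ} (u : X → Fin k → ℝ)
    (A₀ : Matrix (Fin k) (Fin k) ℝ) (hA₀ : IsUnit A₀.det) (hne : ∀ x, A₀ *ᵥ u x ≠ 0)
    (hmin : ∀ A : Matrix (Fin k) (Fin k) ℝ, IsUnit A.det →
      ∑ x, Real.log (A₀ *ᵥ u x ⬝ᵥ A₀ *ᵥ u x) -
          (Fintype.card X : ℝ) / k * Real.log (A₀.det ^ 2) ≤
        ∑ x, Real.log (A *ᵥ u x ⬝ᵥ A *ᵥ u x) - (Fintype.card X : ℝ) / k * Real.log (A.det ^ 2)) :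
    ∀ w : Fin k → ℝ, ∑ x, (A₀ *ᵥ u x ⬝ᵥ w) ^ 2 / (A₀ *ᵥ u x ⬝ᵥ A₀ *ᵥ u x) =
      (Fintype.card X : ℝ) / k * (w ⬝ᵥ w) := by
  set W : X → Fin k → ℝ := fun x => A₀ *ᵥ u x with hWdef
  set nX : ℝ := (Fintype.card X : ℝ) / k with hnX
  have hWpos : ∀ x, 0 < W x ⬝ᵥ W x := fun x =>
    lt_of_le_of_ne (Finset.sum_nonneg fun l _ => mul_self_nonneg _)
      (fun h => hne x (dotProduct_self_eq_zero.mp h.symm))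
  have hd0 : A₀.det ≠ 0 := hA₀.ne_zero
  refine quadForm_of_entries W nX (fun i j => ?_)
  -- the one-parameter family `t ↦ (1 + t E_{ij}) A₀`
  obtain ⟨c, hc⟩ := det_one_add_smul_single i j
  set δ : ℝ := if i = j then 1 else 0 with hδ
  set P : ℝ → ℝ := fun t => 1 + δ * t + c.eval t * t ^ 2 with hPdef
  have hP0 : P 0 = 1 := by simp [hPdef]
  -- the explicit function
  set f : ℝ → ℝ := fun t => ∑ x, Real.log (W x ⬝ᵥ W x + 2 * t * (W x i * W x j) + t ^ 2 * W x j ^ 2)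
    - nX * Real.log ((P t * A₀.det) ^ 2) with hfdef
  -- `f t = Φ((1 + tE) A₀)` and `f 0 = Φ(A₀)`
  have hft : ∀ t, f t = ∑ x, Real.log (((1 + t • Matrix.single i j (1 : ℝ)) * A₀) *ᵥ u x ⬝ᵥ
      ((1 + t • Matrix.single i j (1 : ℝ)) * A₀) *ᵥ u x) -
      nX * Real.log (((1 + t • Matrix.single i j (1 : ℝ)) * A₀).det ^ 2) := by
    intro t
    simp only [hfdef]
    congr 1
    · refine Finset.sum_congr rfl fun x _ => ?_
      rw [← Matrix.mulVec_mulVec, one_add_smul_single_mulVec, dotProduct_self_perturb]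
    · rw [Matrix.det_mul, hc t]
  have hf0 : f 0 = ∑ x, Real.log (W x ⬝ᵥ W x) - nX * Real.log (A₀.det ^ 2) := by
    simp [hfdef, hP0]
  -- local minimality at `0`
  have hPcont : Continuous P := by
    simp only [hPdef]
    exact (continuous_const.add (continuous_const.mul continuous_id)).add
      ((Polynomial.continuous c).mul (continuous_id.pow 2))
  have hPne : ∀ᶠ t in nhds (0 : ℝ), P t ≠ 0 := by
    have hopen : IsOpen {t : ℝ | P t ≠ 0} := isOpen_ne_fun hPcont continuous_const
    exact hopen.mem_nhds (by simp [hP0])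
  have hlocal : IsLocalMin f 0 := by
    filter_upwards [hPne] with t ht
    rw [hf0, hft t]
    have hunit : IsUnit ((1 + t • Matrix.single i j (1 : ℝ)) * A₀).det := by
      rw [Matrix.det_mul, hc t]
      exact (isUnit_iff_ne_zero.mpr ht).mul hA₀
    exact hmin _ hunit
  -- the derivative at `0`
  have hderiv : HasDerivAt f (∑ x, 2 * (W x i * W x j) / (W x ⬝ᵥ W x) - nX * (2 * δ)) 0 := by
    have hq : ∀ x, HasDerivAt (fun t => W x ⬝ᵥ W x + 2 * t * (W x i * W x j) + t ^ 2 * W x j ^ 2)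
        (2 * (W x i * W x j)) 0 := by
      intro x
      have h1 : HasDerivAt (fun t : ℝ => 2 * t * (W x i * W x j)) (2 * 1 * (W x i * W x j)) 0 :=
        ((hasDerivAt_id (0 : ℝ)).const_mul 2).mul_const _
      have h2 : HasDerivAt (fun t : ℝ => t ^ 2 * W x j ^ 2) (((2 : ℕ) : ℝ) * (0 : ℝ) ^ (2 - 1) * W x j ^ 2) 0 :=
        (hasDerivAt_pow 2 (0 : ℝ)).mul_const _
      exact (((hasDerivAt_const (0 : ℝ) (W x ⬝ᵥ W x)).add h1).add h2).congr_deriv (by simp)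
    have hlogq : ∀ x, HasDerivAt
        (fun t => Real.log (W x ⬝ᵥ W x + 2 * t * (W x i * W x j) + t ^ 2 * W x j ^ 2))
        (2 * (W x i * W x j) / (W x ⬝ᵥ W x)) 0 := by
      intro x
      have h0 : W x ⬝ᵥ W x + 2 * 0 * (W x i * W x j) + 0 ^ 2 * W x j ^ 2 ≠ 0 := by
        have := (hWpos x).ne'
        simpa using this
      exact ((hq x).log h0).congr_deriv (by simp)
    have hsum := HasDerivAt.fun_sum (u := Finset.univ) fun x _ => hlogq x
    have hPd : HasDerivAt P δ 0 := by
      have h1 : HasDerivAt (fun t : ℝ => 1 + δ * t) (δ * 1) 0 :=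
        ((hasDerivAt_id (0 : ℝ)).const_mul δ).const_add 1
      have h2 : HasDerivAt (fun t : ℝ => c.eval t * t ^ 2)
          (c.derivative.eval 0 * (0 : ℝ) ^ 2 + c.eval 0 * (((2 : ℕ) : ℝ) * (0 : ℝ) ^ (2 - 1))) 0 :=
        (c.hasDerivAt 0).mul (hasDerivAt_pow 2 (0 : ℝ))
      exact (h1.add h2).congr_deriv (by simp)
    have hg : HasDerivAt (fun t => (P t * A₀.det) ^ 2) (((2 : ℕ) : ℝ) * (P 0 * A₀.det) ^ (2 - 1) *
        (δ * A₀.det)) 0 := (hPd.mul_const A₀.det).pow 2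
    have hlogg : HasDerivAt (fun t => Real.log ((P t * A₀.det) ^ 2)) (2 * δ) 0 := by
      have hne0 : (P 0 * A₀.det) ^ 2 ≠ 0 := by rw [hP0, one_mul]; exact pow_ne_zero 2 hd0
      refine (hg.log hne0).congr_deriv ?_
      rw [hP0, one_mul]
      field_simp
      ring
    exact hsum.fun_sub (hlogg.const_mul nX)
  -- conclude
  have hzero := hlocal.hasDerivAt_eq_zero hderiv
  have h2 : ∑ x, 2 * (W x i * W x j) / (W x ⬝ᵥ W x) = 2 * ∑ x, W x i * W x j / (W x ⬝ᵥ W x) := by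
    rw [Finset.mul_sum]
    exact Finset.sum_congr rfl fun x _ => by ring
  rw [h2] at hzero
  have : ∑ x, W x i * W x j / (W x ⬝ᵥ W x) = nX * δ := by linarith
  rw [this]

end Summit.QuantumAdvantage.QuantumAdvantage.Theorems.HankelLift.Forster
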